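import Mathlib
import HarnessLib
import Literature.Probability.Percolation.BlockResampling
import Literature.Probability.Percolation.InfiniteClusterDensity
import Literature.Probability.Percolation.BondPercolationSymmetry
import Literature.Probability.Percolation.LatticeSymmetry
import Literature.Probability.Percolation.PercolationEvents

/-!
# Crux `PercTreeValue.TetrahedronHarrisGap` (stmt-CriticalPhenomena-7799), line `SketchIdeator1`
# (corner-ball total covariance, rev 5) — stub `stub_mirror`

Helper file for the crux skeleton `Cruxes/TetrahedronHarrisGap/Lines/SketchIdeator1.lean`
(lead prover-line-stmt-CriticalPhenomena-7799-c1-0), `--supports stmt-CriticalPhenomena-7799`.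
No new definitions; everything is stated in the tree's vocabulary (`blockCondProb`, `armEdges`,
`openConn`, `BondConfig.relabel`, `sym2Equiv`, `zdGraph`, `criticalProbI`).

The registered stub `stub_mirror` is the lattice SYMMETRY exchanging the two pairings of the
lattice tetrahedron `0`, `a_r = (r,r,0)`, `b_r = (r,0,r)`, `c_r = (0,r,r)` of `ℤ³`: the involution
`σ_r : x ↦ (r − x₀, x₁, r − x₂)` is a graph automorphism of `ℤ³` with `0 ↦ b_r`, `a_r ↦ c_r`,
`b_r ↦ 0`, `c_r ↦ a_r`; it maps the corner block
`K_r = armEdges (r/8) 0 ∪ armEdges (r/8) a_r ∪ armEdges (r/8) b_r ∪ armEdges (r/8) c_r` onto itself,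
and relabelling configurations along it (`σ̂_r = BondConfig.relabel (sym2Equiv σ_r)`, under which
`P_p` is invariant, `bondPercolation_real_preimage_relabel_iso`) exchanges the two bulk hook
probabilities `f_r = P(0 ↔ a_r | ω off K_r)` and `g_r = P(b_r ↔ c_r | ω off K_r)`:
`g_r = f_r ∘ σ̂_r`, `f_r = g_r ∘ σ̂_r`.

Ingredients (all elementary transport statements, Grimmett 1999 §1.6 "invariance of `P_p` under
the symmetries of the lattice"):

* `relabel_sdiff_union_obs` — relabelling is an image map, so it commutes with gluing a block
  observation: `e2 '' (ω ∖ B ∪ obs ζ B) = e2 '' ω ∖ e2 '' B ∪ obs (e2 '' ζ) (e2 '' B)`;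
* `blockCondProb_map_relabel` — **equivariance of the written-out conditional probability**:
  `P^{G'}(E | e2 '' ω off e2 '' B) = P^{G}((e2 '' ·)⁻¹ E | ω off B)` for a graph isomorphism
  `φ : G ≃g G'`, `e2 = sym2Equiv φ` (`blockCondProb_eq_real` on both sides and
  `bondPercolation_real_preimage_relabel_iso`);
* `preimage_relabel_openConn` — `(φ '' ·)⁻¹ {φ x ↔ φ y} = {x ↔ y}` (`reachable_relabel_iff`);
* `armEdges_map_sym2Equiv` — an automorphism of `ℤ^d` preserving sup-distances to `z` maps
  `armEdges m z` onto `armEdges m (φ z)`;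
* `stub_mirror` — the registered signature, with `φ = zdShiftIso (r,0,r) ∘ zdSignedPermIso 1 (−,+,−)`.
-/

noncomputable section

open MeasureTheory Literature.Probability.Percolation Literature.Probability.LatticeModels

namespace Summit.CriticalPhenomena.PercolationContinuityZ3.Theorems.TetrahedronHarrisGap

/-- **Relabelling commutes with gluing a block observation.** For a bijection of pairs `e2` (acting on
configurations as the image map `ω ↦ e2 '' ω`), a finite block `B` and configurations `ω`, `ζ`:
`e2 '' (ω ∖ B ∪ obs ζ B) = (e2 '' ω) ∖ (e2 '' B) ∪ obs (e2 '' ζ) (e2 '' B)`. -/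
theorem relabel_sdiff_union_obs {V W : Type*} (e2 : Sym2 V ≃ Sym2 W) (B : Finset (Sym2 V))
    (ω ζ : BondConfig V) :
    BondConfig.relabel e2 (ω \ ↑B ∪ ↑(obs ζ B)) =
      BondConfig.relabel e2 ω \ ↑(B.map e2.toEmbedding) ∪
        ↑(obs (BondConfig.relabel e2 ζ) (B.map e2.toEmbedding)) := by
  ext z
  simp only [Set.mem_union, Set.mem_sdiff, Finset.mem_coe, mem_obs_iff, BondConfig.mem_relabel_iff,
    Finset.mem_map_equiv]

/-- **Equivariance of `P_p(E | ω off B)` under graph isomorphisms.** For `φ : G ≃g G'` and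
`e2 = sym2Equiv φ`, the written-out conditional probability on `G'` of `E`, given the relabelled
configuration `e2 '' ω` off the relabelled block `e2 '' B`, equals the conditional probability on `G`
of the pulled-back event `(e2 '' ·)⁻¹ E` given `ω` off `B`:
`blockCondProb G' p (B.map e2) E (e2 '' ω) = blockCondProb G p B ((e2 '' ·)⁻¹' E) ω`.
(Both sides are `P_p`-probabilities of glued configurations, `blockCondProb_eq_real`; `P_p^G` is carried
to `P_p^{G'}` by `e2 '' ·`, `bondPercolation_real_preimage_relabel_iso`, and gluing commutes with
relabelling, `relabel_sdiff_union_obs`.  Grimmett 1999, §1.6.) -/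
theorem blockCondProb_map_relabel {V W : Type*} [Countable V] [Countable W]
    {G : SimpleGraph V} {G' : SimpleGraph W} (φ : G ≃g G') (p : unitInterval)
    (B : Finset (Sym2 V)) (E : Set (BondConfig W)) (ω : BondConfig V) :
    blockCondProb G' p (B.map (sym2Equiv φ.toEquiv).toEmbedding) E
        (BondConfig.relabel (sym2Equiv φ.toEquiv) ω) =
      blockCondProb G p B (BondConfig.relabel (sym2Equiv φ.toEquiv) ⁻¹' E) ω := by
  rw [blockCondProb_eq_real, blockCondProb_eq_real,
    ← bondPercolation_real_preimage_relabel_iso φ p]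
  congr 1
  ext ζ
  simp only [Set.mem_preimage, Set.mem_setOf_eq]
  rw [relabel_sdiff_union_obs]

/-- **Connection events are transported by relabelling**: `(φ '' ·)⁻¹ {φ x ↔ φ y} = {x ↔ y}` for a graph
isomorphism `φ` (the open graph of `φ '' ω` is isomorphic to that of `ω` along `φ`,
`reachable_relabel_iff`). -/
theorem preimage_relabel_openConn {V W : Type*} {G : SimpleGraph V} {G' : SimpleGraph W}
    (φ : G ≃g G') (x y : V) :
    BondConfig.relabel (sym2Equiv φ.toEquiv) ⁻¹' openConn (φ x) (φ y) = openConn x y := by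
  ext ω
  exact reachable_relabel_iff φ.toEquiv ω x y

/-- **Transport of the corner edge sets.** If the automorphism `φ` of `ℤ^d` preserves sup-distances to
the centre `z` at scale `m` (`φ w − φ z ∈ B(m) ↔ w − z ∈ B(m)`; e.g. any composite of a signed
coordinate permutation and a translation), then it maps the edges touching the box `z + B(m)` onto the
edges touching `φ z + B(m)`: `(armEdges m z).map (sym2Equiv φ) = armEdges m (φ z)`. -/
theorem armEdges_map_sym2Equiv {d : ℕ} (φ : zdGraph d ≃g zdGraph d) (m : ℕ) (z : Site d)
    (h : ∀ w : Site d, φ w + -φ z ∈ box d m ↔ w + -z ∈ box d m) :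
    (armEdges m z).map (sym2Equiv φ.toEquiv).toEmbedding = armEdges m (φ z) := by
  ext e
  obtain ⟨e, rfl⟩ := (sym2Equiv φ.toEquiv).surjective e
  rw [Finset.mem_map_equiv, Equiv.symm_apply_apply]
  induction e using Sym2.ind with
  | h u v =>
    simp only [sym2Equiv_mk, mem_armEdges_iff, mem_edgesTouching_iff, SimpleGraph.mem_edgeSet,
      zdGraph_adj_shift_iff, RelIso.coe_fn_toEquiv, φ.map_rel_iff, Sym2.mem_iff, and_or_left,
      exists_or, exists_eq_right]
    simp only [Site.shift_apply, h]

/-- **stub_mirror** (registered stub of line `SketchIdeator1`, crux stmt-CriticalPhenomena-7799). The lattice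
involution `σ_r : x ↦ (r − x₀, x₁, r − x₂)` is a graph automorphism of `ℤ³` exchanging `0 ↔ b_r` and
`a_r ↔ c_r` (`a_r = (r,r,0)`, `b_r = (r,0,r)`, `c_r = (0,r,r)`); it maps the corner block `K_r` to
itself, and relabelling configurations along it exchanges the two bulk hook probabilities:
`g_r = f_r ∘ σ̂_r` and `f_r = g_r ∘ σ̂_r` (`σ̂_r = BondConfig.relabel (sym2Equiv σ_r)`).
Witness: `φ = zdShiftIso (r,0,r) ∘ zdSignedPermIso 1 (−1, 1, −1)`; the two function identities are
`blockCondProb_map_relabel` with `K_r.map (sym2Equiv φ) = K_r` (`armEdges_map_sym2Equiv`) and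
`(φ '' ·)⁻¹ {φ x ↔ φ y} = {x ↔ y}` (`preimage_relabel_openConn`). (Grimmett 1999, §1.6.) -/
theorem stub_mirror :
    ∀ r : ℕ, ∃ φ : zdGraph 3 ≃g zdGraph 3,
      φ 0 = ![(r : ℤ), 0, (r : ℤ)] ∧ φ ![(r : ℤ), (r : ℤ), 0] = ![0, (r : ℤ), (r : ℤ)] ∧
      φ ![(r : ℤ), 0, (r : ℤ)] = 0 ∧ φ ![0, (r : ℤ), (r : ℤ)] = ![(r : ℤ), (r : ℤ), 0] ∧
      (∀ ω : BondConfig (Site 3),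
        blockCondProb (zdGraph 3) (criticalProbI 3)
            (armEdges (r / 8) (0 : Site 3) ∪ armEdges (r / 8) ![(r : ℤ), (r : ℤ), 0] ∪
              armEdges (r / 8) ![(r : ℤ), 0, (r : ℤ)] ∪ armEdges (r / 8) ![0, (r : ℤ), (r : ℤ)])
            (openConn ![(r : ℤ), 0, (r : ℤ)] ![0, (r : ℤ), (r : ℤ)]) ω =
          blockCondProb (zdGraph 3) (criticalProbI 3)
            (armEdges (r / 8) (0 : Site 3) ∪ armEdges (r / 8) ![(r : ℤ), (r : ℤ), 0] ∪
              armEdges (r / 8) ![(r : ℤ), 0, (r : ℤ)] ∪ armEdges (r / 8) ![0, (r : ℤ), (r : ℤ)])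
            (openConn (0 : Site 3) ![(r : ℤ), (r : ℤ), 0]) (BondConfig.relabel (sym2Equiv φ.toEquiv) ω)) ∧
      (∀ ω : BondConfig (Site 3),
        blockCondProb (zdGraph 3) (criticalProbI 3)
            (armEdges (r / 8) (0 : Site 3) ∪ armEdges (r / 8) ![(r : ℤ), (r : ℤ), 0] ∪
              armEdges (r / 8) ![(r : ℤ), 0, (r : ℤ)] ∪ armEdges (r / 8) ![0, (r : ℤ), (r : ℤ)])
            (openConn (0 : Site 3) ![(r : ℤ), (r : ℤ), 0]) ω =
          blockCondProb (zdGraph 3) (criticalProbI 3)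
            (armEdges (r / 8) (0 : Site 3) ∪ armEdges (r / 8) ![(r : ℤ), (r : ℤ), 0] ∪
              armEdges (r / 8) ![(r : ℤ), 0, (r : ℤ)] ∪ armEdges (r / 8) ![0, (r : ℤ), (r : ℤ)])
            (openConn ![(r : ℤ), 0, (r : ℤ)] ![0, (r : ℤ), (r : ℤ)]) (BondConfig.relabel (sym2Equiv φ.toEquiv) ω)) := by
  intro r
  -- the lattice involution `σ_r : x ↦ (r - x₀, x₁, r - x₂)` as a graph automorphism of `ℤ³`
  set φ : zdGraph 3 ≃g zdGraph 3 :=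
    (zdSignedPermIso (1 : Equiv.Perm (Fin 3)) ![-1, 1, -1]).trans (zdShiftIso ![(r : ℤ), 0, (r : ℤ)])
    with hφdef
  have h1symm : ∀ i : Fin 3, (Equiv.symm (1 : Equiv.Perm (Fin 3))) i = i := fun i => rfl
  have hφ : ∀ x : Site 3, φ x = ![(r : ℤ) - x 0, x 1, (r : ℤ) - x 2] := by
    intro x
    rw [hφdef]
    ext i
    fin_cases i <;> simp [h1symm] <;> ring
  have h0 : φ 0 = ![(r : ℤ), 0, (r : ℤ)] := by
    rw [hφ]; ext i; fin_cases i <;> simp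
  have ha : φ ![(r : ℤ), (r : ℤ), 0] = ![0, (r : ℤ), (r : ℤ)] := by
    rw [hφ]; ext i; fin_cases i <;> simp
  have hb : φ ![(r : ℤ), 0, (r : ℤ)] = 0 := by
    rw [hφ]; ext i; fin_cases i <;> simp
  have hc : φ ![0, (r : ℤ), (r : ℤ)] = ![(r : ℤ), (r : ℤ), 0] := by
    rw [hφ]; ext i; fin_cases i <;> simp
  -- `φ` preserves sup-distances, hence maps each corner edge set to the corner edge set of the image
  have hbox : ∀ (m : ℕ) (z w : Site 3), φ w + -φ z ∈ box 3 m ↔ w + -z ∈ box 3 m := by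
    intro m z w
    rw [mem_box, mem_box, hφ, hφ]
    refine forall_congr' fun i => ?_
    fin_cases i <;> simp <;> omega
  have hmap : ∀ z : Site 3, (armEdges (r / 8) z).map (sym2Equiv φ.toEquiv).toEmbedding =
      armEdges (r / 8) (φ z) := fun z => armEdges_map_sym2Equiv φ (r / 8) z (hbox (r / 8) z)
  -- `K_r` is `φ`-invariant (φ permutes the four centres)
  have hK : (armEdges (r / 8) (0 : Site 3) ∪ armEdges (r / 8) ![(r : ℤ), (r : ℤ), 0] ∪
        armEdges (r / 8) ![(r : ℤ), 0, (r : ℤ)] ∪ armEdges (r / 8) ![0, (r : ℤ), (r : ℤ)]).map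
        (sym2Equiv φ.toEquiv).toEmbedding =
      armEdges (r / 8) (0 : Site 3) ∪ armEdges (r / 8) ![(r : ℤ), (r : ℤ), 0] ∪
        armEdges (r / 8) ![(r : ℤ), 0, (r : ℤ)] ∪ armEdges (r / 8) ![0, (r : ℤ), (r : ℤ)] := by
    simp only [Finset.map_union, hmap, h0, ha, hb, hc]
    ext e
    simp only [Finset.mem_union, or_comm, or_assoc, or_left_comm]
  -- equivariance of the bulk hook probabilities
  have key : ∀ (x y : Site 3) (ω : BondConfig (Site 3)),
      blockCondProb (zdGraph 3) (criticalProbI 3)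
          (armEdges (r / 8) (0 : Site 3) ∪ armEdges (r / 8) ![(r : ℤ), (r : ℤ), 0] ∪
            armEdges (r / 8) ![(r : ℤ), 0, (r : ℤ)] ∪ armEdges (r / 8) ![0, (r : ℤ), (r : ℤ)])
          (openConn (φ x) (φ y)) (BondConfig.relabel (sym2Equiv φ.toEquiv) ω) =
        blockCondProb (zdGraph 3) (criticalProbI 3)
          (armEdges (r / 8) (0 : Site 3) ∪ armEdges (r / 8) ![(r : ℤ), (r : ℤ), 0] ∪
            armEdges (r / 8) ![(r : ℤ), 0, (r : ℤ)] ∪ armEdges (r / 8) ![0, (r : ℤ), (r : ℤ)])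
          (openConn x y) ω := by
    intro x y ω
    conv_lhs => rw [← hK]
    rw [blockCondProb_map_relabel, preimage_relabel_openConn]
  refine ⟨φ, h0, ha, hb, hc, fun ω => ?_, fun ω => ?_⟩
  · have h := key ![(r : ℤ), 0, (r : ℤ)] ![0, (r : ℤ), (r : ℤ)] ω
    rw [hb, hc] at h
    exact h.symm
  · have h := key 0 ![(r : ℤ), (r : ℤ), 0] ω
    rw [h0, ha] at h
    exact h.symm

end Summit.CriticalPhenomena.PercolationContinuityZ3.Theorems.TetrahedronHarrisGap

end
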